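import Summits.BirchSwinnertonDyer.Rank1Residual.X6.RankZeroCertificateErratumRestShape
import HarnessLib

/-!
# Class X6 ∧ analytic rank `0` — the six Rest cells at `p ≥ 5` INHABITED BY NAME in the `hWeq` shape of the
# cell files: `¬ HasErratumPrime`, `ClassX6`, all-split (kernel theorems on Cremona's minimal models)

Cell `bsd-print-x6` (D-0131 (2) print tier, key `x6`; HOME `run/shared/lean/pub/bsd-print-x6/`), typer seat ty3 (gen 4).
Sibling of `RankZeroCertificateErratum.lean` (p548448: `Record.hasErratumPrime_of_check` / `Record.not_hasErratumPrime_of_check`),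
`RankZeroCertificateErratumDisplay.lean` (p551397: the Err ∣ Rest partition; `not_hasErratumPrime_cell_138594b1_at5`,
`classX6_cell_138594b1_at5`) and `RankZeroCertificateErratumRestShape.lean` (p553688: `Record.split_of_mult_of_all_splitAt`,
`rest_five_le_all_splitAt`, `split_of_mult_cell_138594b1_at5`). PARTITION (D-0054): leaf X6 ∧ r = 0 (K3 row A6) —
types-the-object-of; closes NONE. HONEST FRAMING: nothing here asserts BSD or any `L`-value; every theorem below is a
statement about the reduction types / `ord_q Δ_min` / supersingularity of an EXPLICIT minimal model, PROVED from
kernel-rechecked integer data; analytic rank `0` and `#Ш_an` of these cells remain the records' two-engine CLAIMS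
(`RankZeroCertificateClaim.lean`) and are NOT provided here.

WHAT (for the per-cell files of the RESIDUAL child `EisensteinHalfFiveLeRest`, item stmt-BirchSwinnertonDyer-21116 —
e.g. seat p4's `(12927e1, 7)` closure p551746 and its `…FromInputs` vehicle, seat p1's by-name Rest helper p553143):

* §1 generic `hWeq` adapters from a certified record list and a kernel-decided membership:
  `not_hasErratumPrime_of_exists`, `hasErratumPrime_of_exists`, `classX6_of_exists`, `split_of_mult_of_exists` —
  a consumer at ANY of the 734 cells writes `…_of_exists certified_recordsNN (by decide +kernel) hWeq`.
* §2 the five Rest cells at `p ≥ 5` not already named (`138594b1 @ 5` is in the Display / RestShape files):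
  `246697a1, 321518d1, 331554a1 @ 5` and `12927e1, 399190l1 @ 7` — for each, on Cremona's minimal model `hWeq : W = ⟨a₁,…,a₆⟩`:
  `not_hasErratumPrime_cell_<label>_at<p> : ¬ HasErratumPrime W p`, `classX6_cell_<label>_at<p> : ClassX6 W p`,
  `split_of_mult_cell_<label>_at<p> : Mult W q → SplitMult W q` (every bad prime split — `rest_five_le_all_splitAt`);
  `¬ W.HasCM` is then `(classX6_cell_… hWeq).not_hasCM` by name (`ClassX6.not_hasCM`).

Data (Cremona / PARI, two engines = records14–16; bad primes with `ord_q Δ`): `246697a1 = [0,0,1,−292934695,−1929764585205]`,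
`N = 11·41·547`, bad `(11,6),(41,1),(547,1)`; `321518d1 = [1,0,0,−80858,−9082420]`, `N = 2·19·8461`, bad `(2,3),(19,2),(8461,3)`;
`331554a1 = [1,0,0,−3453,−78387]`, `N = 2·3·55259`, bad `(2,2),(3,1),(55259,1)`; `12927e1 = [1,0,0,−42189461,−105479619702]`,
`N = 3·31·139`, bad `(3,1),(31,2),(139,1)`; `399190l1 = [1,−1,1,−8615202972,−2594053676135591]`, `N = 2·5·11·19·191`, bad
`(2,1),(5,1),(11,1),(19,21),(191,2)` — all split multiplicative (so at `399190l1 @ 7` the prime `19` with `7 ∣ 21` is split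
anyway). References: J. H. Silverman, *AEC* (2009) VII.5 Prop. 5.1 [SilvermanAEC2009]; J. E. Cremona, the elliptic curve
database [Cremona2006].
-/

set_option autoImplicit false

open WeierstrassCurve Literature.NumberTheory.EllipticCurves
  Literature.NumberTheory.EllipticCurves.Rank1Residual
  Summit.BirchSwinnertonDyer.Rank1Residual.Supersingular

namespace Summit.BirchSwinnertonDyer.Rank1Residual.X6.PrintCert

/-! ### §1 Generic `hWeq` adapters: from a certified list and a decided membership to the cell's curve -/

section Adapters

variable {rs : List Record} {W : WeierstrassCurve ℚ} [W.IsElliptic] [W.IsGloballyMinimal]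
  {a1 a2 a3 a4 a6 : ℤ} {p : ℕ}

/-- **`¬ HasErratumPrime W p` in the `hWeq` shape** from a certified list containing a record with these a-invariants,
this `p`, and the Rest certificate. [cite: SilvermanAEC2009, VII.5 Prop. 5.1(a) and (b)] -/
theorem not_hasErratumPrime_of_exists (hrs : certified rs = true)
    (h : ∃ r ∈ rs, r.ainvs = [a1, a2, a3, a4, a6] ∧ r.p = p ∧ r.restAt = true)
    (hWeq : W = ⟨a1, a2, a3, a4, a6⟩) : ¬ HasErratumPrime W p := by
  obtain ⟨r, hr, hA, hp, he⟩ := h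
  have hc := check_of_mem_of_certified hrs hr
  have hW : W = r.curve := by rw [hWeq]; exact r.curve_eq hA
  subst hW
  subst hp
  exact r.not_hasErratumPrime_of_check hc he

/-- **`HasErratumPrime W p` in the `hWeq` shape** from a certified list containing a record with these a-invariants,
this `p`, and the Err certificate. [cite: SilvermanAEC2009, VII.5 Prop. 5.1(b)] -/
theorem hasErratumPrime_of_exists (hrs : certified rs = true)
    (h : ∃ r ∈ rs, r.ainvs = [a1, a2, a3, a4, a6] ∧ r.p = p ∧ r.errAt = true)
    (hWeq : W = ⟨a1, a2, a3, a4, a6⟩) : HasErratumPrime W p := by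
  obtain ⟨r, hr, hA, hp, he⟩ := h
  have hc := check_of_mem_of_certified hrs hr
  have hW : W = r.curve := by rw [hWeq]; exact r.curve_eq hA
  subst hW
  subst hp
  exact r.hasErratumPrime_of_check hc he

/-- **`ClassX6 W p` in the `hWeq` shape** from a certified list containing a record with these a-invariants and this
`p` (the recheck certifies good supersingular reduction at `p` with `a_p = 0` and semistability).
[cite: SilvermanAEC2009, VII.5 Prop. 5.1(a) and (b)] -/
theorem classX6_of_exists [Fact p.Prime] (hrs : certified rs = true)
    (h : ∃ r ∈ rs, r.ainvs = [a1, a2, a3, a4, a6] ∧ r.p = p)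
    (hWeq : W = ⟨a1, a2, a3, a4, a6⟩) : ClassX6 W p := by
  obtain ⟨r, hr, hA, hp⟩ := h
  have hc := check_of_mem_of_certified hrs hr
  have hW : W = r.curve := by rw [hWeq]; exact r.curve_eq hA
  subst hW
  subst hp
  exact r.classX6_of_check hc

/-- **All-split in the `hWeq` shape**: from a certified list containing a record with these a-invariants all of whose
listed bad primes carry the split certificate, every multiplicative prime of `W` is split multiplicative.
[cite: SilvermanAEC2009, VII.5 Prop. 5.1(a) and (b)] -/
theorem split_of_mult_of_exists (hrs : certified rs = true)
    (h : ∃ r ∈ rs, r.ainvs = [a1, a2, a3, a4, a6] ∧ (r.bad.all fun t => splitAt r.ainvs t.1) = true)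
    (hWeq : W = ⟨a1, a2, a3, a4, a6⟩) (q : ℕ) [Fact q.Prime] (hmult : W.HasMultiplicativeReductionAtPrime q) :
    W.HasSplitMultiplicativeReductionAtPrime q := by
  obtain ⟨r, hr, hA, hall⟩ := h
  have hc := check_of_mem_of_certified hrs hr
  have hW : W = r.curve := by rw [hWeq]; exact r.curve_eq hA
  subst hW
  exact r.split_of_mult_of_all_splitAt hc hall q hmult

end Adapters

/-! ### §2 The Rest cells at `p ≥ 5`, by name (Cremona's minimal models; `138594b1 @ 5` is in the Display / RestShape files) -/

section Cells

variable {W : WeierstrassCurve ℚ} [W.IsElliptic] [W.IsGloballyMinimal]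

/-- `246697a1 @ 5`: `¬ HasErratumPrime W 5` (bad primes `11, 41, 547`, all split). [cite: Cremona2006, Table 1 (Cremona label 246697a1)] -/
theorem not_hasErratumPrime_cell_246697a1_at5 (hWeq : W = ⟨0, 0, 1, -292934695, -1929764585205⟩) :
    ¬ HasErratumPrime W 5 :=
  not_hasErratumPrime_of_exists (rs := records14) certified_records14 (by decide +kernel) hWeq

/-- `246697a1 @ 5`: `ClassX6 W 5`. [cite: Cremona2006, Table 1 (Cremona label 246697a1)] -/
theorem classX6_cell_246697a1_at5 [Fact (Nat.Prime 5)] (hWeq : W = ⟨0, 0, 1, -292934695, -1929764585205⟩) :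
    ClassX6 W 5 :=
  classX6_of_exists (rs := records14) certified_records14 (by decide +kernel) hWeq

/-- `246697a1 @ 5`: every multiplicative prime is split. [cite: Cremona2006, Table 1 (Cremona label 246697a1)] -/
theorem split_of_mult_cell_246697a1_at5 (hWeq : W = ⟨0, 0, 1, -292934695, -1929764585205⟩) (q : ℕ) [Fact q.Prime]
    (hmult : W.HasMultiplicativeReductionAtPrime q) : W.HasSplitMultiplicativeReductionAtPrime q :=
  split_of_mult_of_exists (rs := records14) certified_records14 (by decide +kernel) hWeq q hmult

/-- `321518d1 @ 5`: `¬ HasErratumPrime W 5` (bad primes `2, 19, 8461`, all split). [cite: Cremona2006, Table 1 (Cremona label 321518d1)] -/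
theorem not_hasErratumPrime_cell_321518d1_at5 (hWeq : W = ⟨1, 0, 0, -80858, -9082420⟩) :
    ¬ HasErratumPrime W 5 :=
  not_hasErratumPrime_of_exists (rs := records15) certified_records15 (by decide +kernel) hWeq

/-- `321518d1 @ 5`: `ClassX6 W 5`. [cite: Cremona2006, Table 1 (Cremona label 321518d1)] -/
theorem classX6_cell_321518d1_at5 [Fact (Nat.Prime 5)] (hWeq : W = ⟨1, 0, 0, -80858, -9082420⟩) : ClassX6 W 5 :=
  classX6_of_exists (rs := records15) certified_records15 (by decide +kernel) hWeq

/-- `321518d1 @ 5`: every multiplicative prime is split. [cite: Cremona2006, Table 1 (Cremona label 321518d1)] -/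
theorem split_of_mult_cell_321518d1_at5 (hWeq : W = ⟨1, 0, 0, -80858, -9082420⟩) (q : ℕ) [Fact q.Prime]
    (hmult : W.HasMultiplicativeReductionAtPrime q) : W.HasSplitMultiplicativeReductionAtPrime q :=
  split_of_mult_of_exists (rs := records15) certified_records15 (by decide +kernel) hWeq q hmult

/-- `331554a1 @ 5`: `¬ HasErratumPrime W 5` (bad primes `2, 3, 55259`, all split). [cite: Cremona2006, Table 1 (Cremona label 331554a1)] -/
theorem not_hasErratumPrime_cell_331554a1_at5 (hWeq : W = ⟨1, 0, 0, -3453, -78387⟩) : ¬ HasErratumPrime W 5 :=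
  not_hasErratumPrime_of_exists (rs := records15) certified_records15 (by decide +kernel) hWeq

/-- `331554a1 @ 5`: `ClassX6 W 5`. [cite: Cremona2006, Table 1 (Cremona label 331554a1)] -/
theorem classX6_cell_331554a1_at5 [Fact (Nat.Prime 5)] (hWeq : W = ⟨1, 0, 0, -3453, -78387⟩) : ClassX6 W 5 :=
  classX6_of_exists (rs := records15) certified_records15 (by decide +kernel) hWeq

/-- `331554a1 @ 5`: every multiplicative prime is split. [cite: Cremona2006, Table 1 (Cremona label 331554a1)] -/
theorem split_of_mult_cell_331554a1_at5 (hWeq : W = ⟨1, 0, 0, -3453, -78387⟩) (q : ℕ) [Fact q.Prime]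
    (hmult : W.HasMultiplicativeReductionAtPrime q) : W.HasSplitMultiplicativeReductionAtPrime q :=
  split_of_mult_of_exists (rs := records15) certified_records15 (by decide +kernel) hWeq q hmult

/-- `12927e1 @ 7` (seat p4's Rest-cell closure p551746 uses this model): `¬ HasErratumPrime W 7` (bad primes `3, 31, 139`,
all split). [cite: Cremona2006, Table 1 (Cremona label 12927e1)] -/
theorem not_hasErratumPrime_cell_12927e1_at7 (hWeq : W = ⟨1, 0, 0, -42189461, -105479619702⟩) :
    ¬ HasErratumPrime W 7 :=
  not_hasErratumPrime_of_exists (rs := records16) certified_records16 (by decide +kernel) hWeq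

/-- `12927e1 @ 7`: `ClassX6 W 7`. [cite: Cremona2006, Table 1 (Cremona label 12927e1)] -/
theorem classX6_cell_12927e1_at7 [Fact (Nat.Prime 7)] (hWeq : W = ⟨1, 0, 0, -42189461, -105479619702⟩) :
    ClassX6 W 7 :=
  classX6_of_exists (rs := records16) certified_records16 (by decide +kernel) hWeq

/-- `12927e1 @ 7`: every multiplicative prime is split. [cite: Cremona2006, Table 1 (Cremona label 12927e1)] -/
theorem split_of_mult_cell_12927e1_at7 (hWeq : W = ⟨1, 0, 0, -42189461, -105479619702⟩) (q : ℕ) [Fact q.Prime]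
    (hmult : W.HasMultiplicativeReductionAtPrime q) : W.HasSplitMultiplicativeReductionAtPrime q :=
  split_of_mult_of_exists (rs := records16) certified_records16 (by decide +kernel) hWeq q hmult

/-- `399190l1 @ 7`: `¬ HasErratumPrime W 7` (bad primes `2, 5, 11, 19, 191`, all split; `ord_19 Δ = 21`).
[cite: Cremona2006, Table 1 (Cremona label 399190l1)] -/
theorem not_hasErratumPrime_cell_399190l1_at7 (hWeq : W = ⟨1, -1, 1, -8615202972, -2594053676135591⟩) :
    ¬ HasErratumPrime W 7 :=
  not_hasErratumPrime_of_exists (rs := records16) certified_records16 (by decide +kernel) hWeq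

/-- `399190l1 @ 7`: `ClassX6 W 7`. [cite: Cremona2006, Table 1 (Cremona label 399190l1)] -/
theorem classX6_cell_399190l1_at7 [Fact (Nat.Prime 7)] (hWeq : W = ⟨1, -1, 1, -8615202972, -2594053676135591⟩) :
    ClassX6 W 7 :=
  classX6_of_exists (rs := records16) certified_records16 (by decide +kernel) hWeq

/-- `399190l1 @ 7`: every multiplicative prime is split. [cite: Cremona2006, Table 1 (Cremona label 399190l1)] -/
theorem split_of_mult_cell_399190l1_at7 (hWeq : W = ⟨1, -1, 1, -8615202972, -2594053676135591⟩) (q : ℕ) [Fact q.Prime]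
    (hmult : W.HasMultiplicativeReductionAtPrime q) : W.HasSplitMultiplicativeReductionAtPrime q :=
  split_of_mult_of_exists (rs := records16) certified_records16 (by decide +kernel) hWeq q hmult

end Cells

end Summit.BirchSwinnertonDyer.Rank1Residual.X6.PrintCert
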